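/-
Copyright (c) 2026. All rights reserved.
Released under Apache 2.0 license as described in the file LICENSE.
Authors: abc-iut cell — seat abc-iut-w4-d104 (gen 4): row «COR29-L-A-ENGAGE» part (A), sharpened hypothesis —
the input additive structure need agree with chart addition only where the chart sum stays in the chart ball.
-/
import Literature.AnabelianGeometry.AbsoluteAnabelian.ArchimedeanReconstructionCor29AdditiveInput
import HarnessLib

/-!
# [AbsTopIII] Cor 2.9 with INPUT local additive structures: the LOCAL linearisation hypothesis

S. Mochizuki, *Topics in absolute anabelian geometry III* (bib key `MochizukiAbsTopIII2015`), Cor 2.9 (a)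
p.64 l.44 – p.65 l.2 with Prop 2.5 (e) p.57 (the local additive structure `a +_p b` is defined for `a, b` in
a NEIGHBOURHOOD of `p`, as parallelogram completion).  PROOF-ONLY file (no definitions); sharpens
`…Cor29AdditiveInput.lean` (p442782).

There the INPUT addition `ladd₀ x` had to agree with the chart-transported addition
`e_x⁻¹(e_x a + e_x b − e_x x)` for ALL `a, b` in the chart domain `W_x` — including pairs whose chart sum
leaves the chart ball, where the transported formula is junk.  A GENUINE local additive structure (the group
law of `E^top` read near `x`, abc-iut-w6-d024's `Cor27c.localAdd_planar_of_isPuncturedEllipticCurve` /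
`Cor27c.genuine_summary`, p443220/p444357: planar on a neighbourhood of `(p, p)`) satisfies the law exactly
where the chart sum stays in the chart: so here the hypothesis is the LOCAL one,

  `hladd : ∀ a b ∈ W_x, e_x a + e_x b − e_x x ∈ B(e_x x, r_x) → ladd₀ x a b = e_x⁻¹(e_x a + e_x b − e_x x)`,

and every row still goes through, because Cor 2.9 only ever adds points of the half-ball
`U_x = {‖e_x v − e_x x‖ < r_x/2}` (sums land in the ball), iterates `k · ((1/n)·ₓ v)` with `k ≤ n` (in the
ball), or orbits `u · v → x` of germ automorphisms (eventually in the ball):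

* `iterate_input_eq_local`, `isLocalAddDatumAt_input_local` (a.r1 incl. `n · ((1/n)·ₓ v) = v`),
  `iotaAdditive_input_local` (a.r6), `scalarFieldIso_input_local` (b.r2, ANY `L`);
* `NFCurveData.cor29Refined_of_chartPackage_input_local` (w5-d225's refined rows, hence the record p408225)
  and `NFCurveData.globalArchimedeanCompatibility'_of_chartPackage_input_local` — abc-iut-L4-t4's successor
  statement of record for the genuine datum, ANY `L`, INPUT additive structures under the local law.

HONEST SCOPE as p442782 (chart package named, not discharged; functoriality record-only).  Refereed pre-IUT
material; nothing here bears on the disputed [IUTchIII] Cor. 3.12; typed ≠ endorsed.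
-/

noncomputable section

namespace Literature.AnabelianGeometry.AbsoluteAnabelian

open _root_.Set _root_.Topology _root_.Filter _root_.Metric _root_.Function
open ArchimedeanReconstruction ArchimedeanReconstruction.Cor29

namespace ArchimedeanReconstruction.Cor29ChartPackage

variable {X : Type} [TopologicalSpace X]
variable {W : Set X} {e : X → ℂ} {e' : ℂ → X} {x : X} {r : ℝ}
variable {ladd₀ : X → X → X} {scale₀ : ℕ → X → X}

omit [TopologicalSpace X] in
/-- Iterates of the input addition along `(1/n)·ₓ v`, under the LOCAL law: the `k`-th iterate (`k ≤ n`) is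
`e⁻¹(e x + k (e v − e x)/n)` — every chart sum met on the way lies in the chart ball.
[cite: MochizukiAbsTopIII2015, Corollary 2.9 (a) p.65] -/
theorem iterate_input_eq_local (hxW : x ∈ W) (he'm : MapsTo e' (ball (e x) r) W)
    (hl : ∀ v ∈ W, e' (e v) = v) (hrt : ∀ w ∈ ball (e x) r, e (e' w) = w)
    (hladd : ∀ a ∈ W, ∀ b ∈ W, e a + e b - e x ∈ ball (e x) r → ladd₀ a b = e' (e a + e b - e x))
    {v : X} (hvr : ‖e v - e x‖ < r) {n : ℕ} (hn : 0 < n) {k : ℕ} (hk : k ≤ n) :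
    (ladd₀ (e' (e x + (e v - e x) / (n : ℂ))))^[k] x = e' (e x + (k : ℂ) * ((e v - e x) / (n : ℂ))) := by
  have hw : e x + (e v - e x) / (n : ℂ) ∈ ball (e x) r := add_div_nat_mem_ball hvr hn
  induction k with
  | zero => simp [hl x hxW]
  | succ k ih =>
    have hk' : k ≤ n := Nat.le_of_succ_le hk
    have hmemk : e x + (k : ℂ) * ((e v - e x) / (n : ℂ)) ∈ ball (e x) r :=
      add_nat_mul_div_nat_mem_ball hvr hn hk'
    have hsum : e (e' (e x + (e v - e x) / (n : ℂ))) + e (e' (e x + (k : ℂ) * ((e v - e x) / (n : ℂ)))) -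
        e x ∈ ball (e x) r := by
      rw [hrt _ hw, hrt _ hmemk]
      convert add_nat_mul_div_nat_mem_ball hvr hn hk using 1
      push_cast; ring
    rw [Function.iterate_succ_apply', ih hk', hladd _ (he'm hw) _ (he'm hmemk) hsum, hrt _ hw, hrt _ hmemk]
    congr 1; push_cast; ring

omit [TopologicalSpace X] in
/-- Sums of two points of the half-ball `U_x` land in the chart ball. (Auxiliary.)
[cite: MochizukiAbsTopIII2015, Corollary 2.9 (a) p.65] -/
theorem add_sub_mem_ball_of_half {a b : X} (ha : ‖e a - e x‖ < r / 2) (hb : ‖e b - e x‖ < r / 2) :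
    e a + e b - e x ∈ ball (e x) r := by
  rw [mem_ball, dist_eq_norm]
  calc ‖e a + e b - e x - e x‖ = ‖(e a - e x) + (e b - e x)‖ := by ring_nf
    _ ≤ ‖e a - e x‖ + ‖e b - e x‖ := norm_add_le _ _
    _ < r / 2 + r / 2 := add_lt_add ha hb
    _ = r := by ring

open Classical in
/-- **Row Cor-29.a.r1 for INPUT local additive structures under the LOCAL linearisation law.**
[cite: MochizukiAbsTopIII2015, Corollary 2.9 (a) pp.64–65] -/
theorem isLocalAddDatumAt_input_local (hr : 0 < r) (hWo : IsOpen W) (hxW : x ∈ W) (he : ContinuousOn e W)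
    (he' : ContinuousOn e' (ball (e x) r)) (he'm : MapsTo e' (ball (e x) r) W)
    (hl : ∀ v ∈ W, e' (e v) = v) (hrt : ∀ w ∈ ball (e x) r, e (e' w) = w)
    (hladd : ∀ a ∈ W, ∀ b ∈ W, e a + e b - e x ∈ ball (e x) r → ladd₀ a b = e' (e a + e b - e x))
    (hscale : ∀ n : ℕ, 0 < n → ∀ v ∈ W, scale₀ n v = e' (e x + (e v - e x) / (n : ℂ))) :
    IsLocalAddDatumAt ladd₀
      (fun n v => if v ∈ W ∧ ‖e v - e x‖ < r / 2 then scale₀ n v else x) x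
      {v | v ∈ W ∧ ‖e v - e x‖ < r / 2} := by
  have h := isLocalAddDatumAt_pkg hr hWo hxW he he' he'm hl hrt
  have hx0 : ‖e x - e x‖ < r / 2 := by rw [sub_self, norm_zero]; positivity
  refine ⟨h.isOpen, h.mem, fun b hb => ?_, fun a ha => ?_, ?_, fun n hn v hv => ?_, fun n hn => ?_,
    fun n hn v hv => ?_⟩
  · rw [hladd x hxW b hb.1 (add_sub_mem_ball_of_half hx0 hb.2)]; exact h.origin_left b hb
  · rw [hladd a ha.1 x hxW (add_sub_mem_ball_of_half ha.2 hx0)]; exact h.origin_right a ha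
  · refine h.continuousOn_ladd.congr fun q hq => ?_
    obtain ⟨h1, h2⟩ := mem_prod.1 hq
    exact hladd q.1 h1.1 q.2 h2.1 (add_sub_mem_ball_of_half h1.2 h2.2)
  · have hv' : v ∈ W ∧ ‖e v - e x‖ < r / 2 := hv
    have hm := h.mapsTo_scale n hn hv
    simp only [if_pos hv'] at hm ⊢
    rwa [hscale n hn v hv'.1]
  · refine (h.continuousOn_scale n hn).congr fun v hv => ?_
    have hv' : v ∈ W ∧ ‖e v - e x‖ < r / 2 := hv
    simp only [if_pos hv', hscale n hn v hv'.1]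
  · have hv' : v ∈ W ∧ ‖e v - e x‖ < r / 2 := hv
    have hvr : ‖e v - e x‖ < r := by linarith [hv'.2]
    simp only [if_pos hv', hscale n hn v hv'.1]
    rw [iterate_input_eq_local hxW he'm hl hrt hladd hvr hn le_rfl]
    have hn' : (n : ℂ) ≠ 0 := by exact_mod_cast hn.ne'
    rw [mul_div_cancel₀ _ hn', add_sub_cancel, hl v hv'.1]

section Values

variable {𝕜 : Type*} [NontriviallyNormedField 𝕜]

omit [TopologicalSpace X] in
open Classical in
/-- **Row a.r6 for INPUT local additive structures under the LOCAL law** (`IotaAdditive`).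
[cite: MochizukiAbsTopIII2015, Corollary 2.9 (a) p.65] -/
theorem iotaAdditive_input_local (κ : ℂ ≃+* 𝕜) (hr : 0 < r) (hrt : ∀ w ∈ ball (e x) r, e (e' w) = w)
    (hladd : ∀ a ∈ W, ∀ b ∈ W, e a + e b - e x ∈ ball (e x) r → ladd₀ a b = e' (e a + e b - e x))
    (hscale : ∀ n : ℕ, 0 < n → ∀ v ∈ W, scale₀ n v = e' (e x + (e v - e x) / (n : ℂ))) :
    IotaAdditive (𝕜 := 𝕜) ladd₀ (fun n v => if v ∈ W ∧ ‖e v - e x‖ < r / 2 then scale₀ n v else x)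
      {v | v ∈ W ∧ ‖e v - e x‖ < r / 2} (fun v => (κ (e v - e x)) • (LinearMap.id : 𝕜 →ₗ[𝕜] 𝕜)) := by
  have h := iotaAdditive_pkg (W := W) (e := e) (e' := e') (x := x) κ hr hrt
  refine ⟨fun a ha b hb hab => ?_, fun n hn v hv => ?_⟩
  · have heq := hladd a ha.1 b hb.1 (add_sub_mem_ball_of_half ha.2 hb.2)
    have hab' : e' (e a + e b - e x) ∈ {v | v ∈ W ∧ ‖e v - e x‖ < r / 2} := by rwa [← heq]
    rw [heq]
    exact h.1 a ha b hb hab'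
  · have hv' : v ∈ W ∧ ‖e v - e x‖ < r / 2 := hv
    have h2 := h.2 n hn v hv
    simp only [if_pos hv'] at h2 ⊢
    rwa [hscale n hn v hv'.1]

/-- **Row b.r2 for INPUT local additive structures under the LOCAL law, ANY `L`** (`ScalarFieldIso`): the
orbits `u · v` tend to `x`, so the chart sum of two of them is eventually in the chart ball, where the input
`+ₓ` is chart addition. [cite: MochizukiAbsTopIII2015, Corollary 2.9 (b) p.65] -/
theorem scalarFieldIso_input_local (L : LocalLinearHolStructure X) (κ : ℂ ≃+* 𝕜) (κu : ℂˣ ≃ₜ* 𝕜ˣ)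
    (hκu : ∀ c : ℂˣ, ((κu c : 𝕜ˣ) : 𝕜) = κ c)
    (hr : 0 < r) (hWo : IsOpen W) (hxW : x ∈ W) (he : ContinuousOn e W)
    (hem : MapsTo e W (ball (e x) r)) (he' : ContinuousOn e' (ball (e x) r))
    (he'm : MapsTo e' (ball (e x) r) W) (hl : ∀ v ∈ W, e' (e v) = v)
    (hrt : ∀ w ∈ ball (e x) r, e (e' w) = w)
    (hladd : ∀ a ∈ W, ∀ b ∈ W, e a + e b - e x ∈ ball (e x) r → ladd₀ a b = e' (e a + e b - e x)) :
    ScalarFieldIso (𝕜 := 𝕜) L x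
      (fun u v => e' (e x + ((((L.isoUnits x).symm u : ℂˣ) : ℂ) * (e v - e x))))
      ladd₀
      (fun v => (κ (e v - e x)) • (LinearMap.id : 𝕜 →ₗ[𝕜] 𝕜))
      ((L.isoUnits x).symm.trans κu) := by
  have h := scalarFieldIso_pkg_of L κ κu hκu hr hWo hxW he hem he' he'm hl hrt
  refine ⟨h.1, fun φ ψ χ hsum => h.2 φ ψ χ ?_⟩
  beta_reduce at hsum ⊢
  set cφ : ℂ := ((((L.isoUnits x).symm φ : ℂˣ) : ℂ)) with hcφ
  set cψ : ℂ := ((((L.isoUnits x).symm ψ : ℂˣ) : ℂ)) with hcψ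
  filter_upwards [hsum, eventually_pkg_act hWo hxW he hem hrt cφ, eventually_pkg_act hWo hxW he hem hrt cψ,
    eventually_pkg_act hWo hxW he hem hrt (cφ + cψ)] with v hv hφ hψ hφψ
  have hball : e (e' (e x + cφ * (e v - e x))) + e (e' (e x + cψ * (e v - e x))) - e x ∈ ball (e x) r := by
    rw [hφ.2, hψ.2]
    convert hφψ.1 using 1
    ring
  rw [hv, hladd _ (he'm hφ.1) _ (he'm hψ.1) hball]

end Values

end ArchimedeanReconstruction.Cor29ChartPackage

/-! ## Cor 2.9 for the genuine datum under the local linearisation law -/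

namespace ArchimedeanReconstruction

open Cor29 Cor29ChartPackage

open Classical in
/-- **[AbsTopIII] Cor 2.9 refined rows for the GENUINE datum, ANY `L`, INPUT local additive structures under
the LOCAL linearisation law** (otherwise verbatim p442782's `cor29Refined_of_chartPackage_input`).
[cite: MochizukiAbsTopIII2015, Corollary 2.9 pp.64–65] -/
theorem NFCurveData.cor29Refined_of_chartPackage_input_local (D : NFCurveData)
    (L : LocalLinearHolStructure D.Xtop) (isNFPoint : D.Xtop → Prop)
    (W : D.Xtop → Set D.Xtop) (e : D.Xtop → D.Xtop → ℂ) (e' : D.Xtop → ℂ → D.Xtop) (r : D.Xtop → ℝ)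
    (hr : ∀ x, isNFPoint x → 0 < r x) (hW : ∀ x, isNFPoint x → IsOpen (W x) ∧ x ∈ W x)
    (he : ∀ x, isNFPoint x → ContinuousOn (e x) (W x) ∧ MapsTo (e x) (W x) (ball (e x x) (r x)))
    (he' : ∀ x, isNFPoint x →
      ContinuousOn (e' x) (ball (e x x) (r x)) ∧ MapsTo (e' x) (ball (e x x) (r x)) (W x))
    (hl : ∀ x, isNFPoint x → ∀ v ∈ W x, e' x (e x v) = v)
    (hrt : ∀ x, isNFPoint x → ∀ w ∈ ball (e x x) (r x), e x (e' x w) = w)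
    (ladd₀ : D.Xtop → D.Xtop → D.Xtop → D.Xtop) (scale₀ : D.Xtop → ℕ → D.Xtop → D.Xtop)
    (hladd : ∀ x, isNFPoint x → ∀ a ∈ W x, ∀ b ∈ W x, e x a + e x b - e x x ∈ ball (e x x) (r x) →
      ladd₀ x a b = e' x (e x a + e x b - e x x))
    (hscale : ∀ x, isNFPoint x → ∀ n : ℕ, 0 < n → ∀ v ∈ W x,
      scale₀ x n v = e' x (e x x + (e x v - e x x) / (n : ℂ)))
    (fval : D.Fn → D.Xtop → D.kv) (vanishesAt : D.Fn → D.Xtop → Prop) (G : D.Xtop → D.Fn → ℂ → ℂ)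
    (κ : ℂ ≃+* D.kv) (hκ : Continuous κ) (hκ' : Continuous κ.symm)
    (hG : ∀ x, isNFPoint x → ∀ f, vanishesAt f x → DifferentiableAt ℂ (G x f) (e x x) ∧
      (∀ᶠ u in 𝓝 x, κ.symm (fval f u) = G x f (e x u)) ∧ fval f x = 0)
    (hvan : ∀ f x, vanishesAt f x → fval f x = 0)
    (hspan : ∀ x, isNFPoint x → ∃ f, vanishesAt f x ∧ deriv (G x f) (e x x) ≠ 0) :
    D.Cor29Refined L isNFPoint (fun _ => D.kv) (fun x f => κ (deriv (G x f) (e x x))) vanishesAt ladd₀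
      (fun x n v => if v ∈ W x ∧ ‖e x v - e x x‖ < r x / 2 then scale₀ x n v else x) fval
      (fun x u v => e' x (e x x + ((((L.isoUnits x).symm u : ℂˣ) : ℂ) * (e x v - e x x)))) := by
  refine ⟨(D.cor29Refined_of_chartPackage_of L isNFPoint W e e' r hr hW he he' hl hrt fval vanishesAt G κ hκ
      hκ' hG hvan hspan).span, hvan, ?_⟩
  refine ⟨fun x => {v | v ∈ W x ∧ ‖e x v - e x x‖ < r x / 2},
    fun x v => (κ (e x v - e x x)) • (LinearMap.id : D.kv →ₗ[D.kv] D.kv),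
    fun x => (L.isoUnits x).symm.trans (unitsOfFieldIso κ hκ hκ'),
    fun x hx => ?_, fun x₁ x₂ _ _ => scalarCompatibleWithTrans_of L (unitsOfFieldIso κ hκ hκ') x₁ x₂⟩
  obtain ⟨hWo, hxW⟩ := hW x hx
  obtain ⟨hec, hem⟩ := he x hx
  obtain ⟨he'c, he'm⟩ := he' x hx
  refine ⟨isLocalAddDatumAt_input_local (hr x hx) hWo hxW hec he'c he'm (hl x hx) (hrt x hx) (hladd x hx)
      (hscale x hx),
    iotaComputesLimits_input κ hκ (hr x hx) hxW he'c (hl x hx) (hrt x hx) (hscale x hx) (hG x hx),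
    iotaIsEmbedding_pkg κ hκ hκ' hec he'c hem (hl x hx) (fun v hv => hv.1),
    iotaAdditive_input_local κ (hr x hx) (hrt x hx) (hladd x hx) (hscale x hx), iota_self_pkg κ,
    scalarFieldIso_input_local L κ (unitsOfFieldIso κ hκ hκ') (fun c => rfl) (hr x hx) hWo hxW hec hem he'c
      he'm (hl x hx) (hrt x hx) (hladd x hx),
    fun v hv n => scale_input_of_not_mem hv n⟩

open Classical in
/-- **[AbsTopIII] Cor 2.9, abc-iut-L4-t4's successor statement of record, for the GENUINE datum, ANY `L`,
with INPUT local additive structures under the LOCAL linearisation law** — the input `+ₓ` agrees with chart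
addition whenever the chart sum stays in the chart ball (`hladd`), `(1/n)·ₓ` is chart division on the chart
domain (`hscale`); otherwise verbatim p442782's `globalArchimedeanCompatibility'_of_chartPackage_input`.
[cite: MochizukiAbsTopIII2015, Corollary 2.9 pp.64–65] -/
theorem NFCurveData.globalArchimedeanCompatibility'_of_chartPackage_input_local (D : NFCurveData)
    (L : LocalLinearHolStructure D.Xtop) (isNFPoint : D.Xtop → Prop)
    (W : D.Xtop → Set D.Xtop) (e : D.Xtop → D.Xtop → ℂ) (e' : D.Xtop → ℂ → D.Xtop) (r : D.Xtop → ℝ)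
    (hr : ∀ x, isNFPoint x → 0 < r x) (hW : ∀ x, isNFPoint x → IsOpen (W x) ∧ x ∈ W x)
    (he : ∀ x, isNFPoint x → ContinuousOn (e x) (W x) ∧ MapsTo (e x) (W x) (ball (e x x) (r x)))
    (he' : ∀ x, isNFPoint x →
      ContinuousOn (e' x) (ball (e x x) (r x)) ∧ MapsTo (e' x) (ball (e x x) (r x)) (W x))
    (hl : ∀ x, isNFPoint x → ∀ v ∈ W x, e' x (e x v) = v)
    (hrt : ∀ x, isNFPoint x → ∀ w ∈ ball (e x x) (r x), e x (e' x w) = w)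
    (ladd₀ : D.Xtop → D.Xtop → D.Xtop → D.Xtop) (scale₀ : D.Xtop → ℕ → D.Xtop → D.Xtop)
    (hladd : ∀ x, isNFPoint x → ∀ a ∈ W x, ∀ b ∈ W x, e x a + e x b - e x x ∈ ball (e x x) (r x) →
      ladd₀ x a b = e' x (e x a + e x b - e x x))
    (hscale : ∀ x, isNFPoint x → ∀ n : ℕ, 0 < n → ∀ v ∈ W x,
      scale₀ x n v = e' x (e x x + (e x v - e x x) / (n : ℂ)))
    (fval : D.Fn → D.Xtop → D.kv) (vanishesAt : D.Fn → D.Xtop → Prop) (G : D.Xtop → D.Fn → ℂ → ℂ)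
    (κ : ℂ ≃+* D.kv) (hκ : Continuous κ) (hκ' : Continuous κ.symm)
    (hG : ∀ x, isNFPoint x → ∀ f, vanishesAt f x → DifferentiableAt ℂ (G x f) (e x x) ∧
      (∀ᶠ u in 𝓝 x, κ.symm (fval f u) = G x f (e x u)) ∧ fval f x = 0)
    (hvan : ∀ f x, vanishesAt f x → fval f x = 0)
    (hspan : ∀ x, isNFPoint x → ∃ f, vanishesAt f x ∧ deriv (G x f) (e x x) ≠ 0) :
    GlobalArchimedeanCompatibility' D L isNFPoint (fun _ => D.kv) (fun x f => κ (deriv (G x f) (e x x)))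
      vanishesAt ladd₀ (fun x n v => if v ∈ W x ∧ ‖e x v - e x x‖ < r x / 2 then scale₀ x n v else x) fval
      (fun x u v => e' x (e x x + ((((L.isoUnits x).symm u : ℂˣ) : ℂ) * (e x v - e x x)))) := by
  have hR := D.cor29Refined_of_chartPackage_input_local L isNFPoint W e e' r hr hW he he' hl hrt ladd₀ scale₀
    hladd hscale fval vanishesAt G κ hκ hκ' hG hvan hspan
  refine ⟨(D.globalArchimedeanCompatibility_of_refined _ _ _ _ _ _ _ _ _ hR).limit_depends_on_differential,
    ?_⟩
  refine ⟨fun x => {v | v ∈ W x ∧ ‖e x v - e x x‖ < r x / 2},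
    fun x v => (κ (e x v - e x x)) • (LinearMap.id : D.kv →ₗ[D.kv] D.kv),
    fun _ _ => κ, fun _ _ => hκ, fun _ _ => hκ', fun x hx => ?_, fun x₁ x₂ _ _ => ?_⟩
  · obtain ⟨hWo, hxW⟩ := hW x hx
    obtain ⟨hec, hem⟩ := he x hx
    obtain ⟨he'c, he'm⟩ := he' x hx
    refine ⟨isLocalAddDatumAt_input_local (hr x hx) hWo hxW hec he'c he'm (hl x hx) (hrt x hx) (hladd x hx)
        (hscale x hx),
      iotaComputesLimits_input κ hκ (hr x hx) hxW he'c (hl x hx) (hrt x hx) (hscale x hx) (hG x hx),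
      iotaIsEmbedding_pkg κ hκ hκ' hec he'c hem (hl x hx) (fun v hv => hv.1),
      iotaAdditive_input_local κ (hr x hx) (hrt x hx) (hladd x hx) (hscale x hx), ?_⟩
    rw [fieldIsoScalar_eq_trans]
    exact scalarFieldIso_input_local L κ (unitsOfFieldIso κ hκ hκ') (fun c => rfl) (hr x hx) hWo hxW hec hem
      he'c he'm (hl x hx) (hrt x hx) (hladd x hx)
  · exact fieldIsoScalar_compatible L x₁ x₂ κ hκ hκ'

end ArchimedeanReconstruction

end Literature.AnabelianGeometry.AbsoluteAnabelian

end
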